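import Summits.QuantumFields.QCD.Theses.SpectralDefectExtinction
import Summits.QuantumFields.QCD.Theorems.ExtinctionBuildsQCD.Negative.WithoutTightCollapse
import Summits.QuantumFields.QCD.Theorems.ExtinctionBuildsQCD.Negative.ExtinctIntegrable
import Summits.QuantumFields.QCD.Theorems.ExtinctionBuildsQCD.Negative.CoercivityCeiling
import Summits.QuantumFields.QCD.Theorems.WindowExtinction.Negative.SpectralFlowLocal
import Literature.MathematicalPhysics.QuantumFieldTheory.SpectralDefectDensity
import Literature.Barriers.QuantumFields.WilsonDeterminantSign
import Summits.QuantumFields.QCD.Theorems.SpectralDefectExtinctionWindowExtinctionKatoBudgetRadius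
import Summits.QuantumFields.QCD.Theorems.SpectralDefectExtinctionWindowExtinctionKatoHermitianEigenForm
import HarnessLib.Audit

/-!
# Crux `WindowExtinction` (stmt-QuantumFields-8964), line `kato-radius-collective-defects`, stub S2b
# `stub_windowCoercivity` — the BOOKKEEPING fragment: EXTA ∧ EXTB(c) ⇒ `Extinct … c`

Worker of lead seat c2 (2026-08-16).  The registered stub S2b asks, for every pinned, mass-scaling,
asymptotically scaling regularisation `reg` and threshold `M₀ ≥ 0` whose sub-level REAL modes of `D_W(U,0,1)`
are extinct in density form (EXTA), for a window constant `c > 0` with `Extinct N_f reg c m` at every tuple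
`m > M₀` — the crux's EXTINCT clause, which integrates the SUM over flavours of the clause-(a) count (real roots
of `charpoly D_W(U,0,1)` below `−(m_crit(k) + a_k m_f/Z_k)`) and the clause-(b) count (eigenvalues of
`Γ₅ D_W(U, m_crit(k) + a_k m_f/Z_k, 1)` in the window `|e| < c a_k m_f/Z_k`).

This file lands the deterministic half of S2b and thereby isolates its open content:

* `extinctRatio_eq_sum_ratioA_add_ratioB` — on every torus and at every step the EXTINCT ratio IS the sum over
  flavours of the clause-(a) ratios at depths `M := m_f` plus the flavour-summed clause-(b) ratio:
  `∫ Σ_f (A_f + B_f) w / ∫ w = Σ_f ∫ A_f w / ∫ w + ∫ (Σ_f B_f) w / ∫ w`, because every spectral count is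
  measurable and bounded by the matrix size (landed `measurable_signDefectCount`,
  `measurable_coercivityDefectCount`, `integrable_natCount_mul_weight`, `countP_roots_charpoly_le_card` of
  `Negative/ExtinctIntegrable.lean`) — no junk-zero Bochner integral is involved.
* `stub_windowCoercivity_bookkeeping` — for ANY `N_f`, `reg`, `M₀ ≥ 0`, `c`: EXTA together with the
  clause-(b) analogue EXTB(c) (phase-quenched expected window count of `H_W(m_f(k))`, summed over flavours,
  `≤ ε((2S+1)/(2L_k+1))⁴` on every torus `S ≥ L_k`, eventually, for every tuple `m > M₀` and every `ε > 0`)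
  give `Extinct N_f reg c m` for every tuple `m > M₀` (run EXTA for each flavour at depth `m_f > M₀ ≥ M₀/2`
  and EXTB at `ε/(N_f+1)`, intersect the `N_f + 1` eventual sets).
* `extinct_iff_windowGap_of_extA` — consequently, GIVEN EXTA, `(∀ m > M₀, Extinct N_f reg c m) ↔ EXTB(c)`
  (converse: `ratioB_le_extinctRatio`, the clause-(a) ratios being non-negative).  So S2b's open content is
  exactly `∃ c > 0, EXTB(c)`: a phase-quenched spectral gap of
  `H_W(m_f(k))` at the window scale `c a_k m_f/Z_k`, of size `o((2L_k+1)⁻⁴)` expected eigenvalues PER SITE.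
  None of S2b's other hypotheses (mass scaling, asymptotic scaling, PINS, the collectivity hypothesis (Hb)) is
  used here; they are inputs of the open probabilistic half EXTB only.
-/

noncomputable section

namespace Summit.QuantumFields.QCD.Cruxes.WindowExtinction.KatoRadiusCollectiveDefects

open scoped BigOperators Classical Matrix ComplexConjugate
open MeasureTheory Filter Matrix
open Literature.MathematicalPhysics.QuantumLattice Literature.MathematicalPhysics.QuantumFieldTheory
  Literature.Probability.LatticeModels
open Summit.QuantumFields.QCD.Theses.SpectralDefectExtinction
open Summit.QuantumFields.QCD.Theorems.ExtinctionBuildsQCD.Negative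

variable {Nf : ℕ}

/-- The clause-(a) ratio of EXTA at step `k`, torus half-side `S`, tuple `m` (weights) and depth `M`:
phase-quenched expected number of real roots of `charpoly D_W(U,0,1)` below `−(m_crit(k) + a_k M/Z_k)`
(verbatim the quantity bounded in EXTA / BOTTOM). -/
noncomputable def ratioA (reg : QCDRegularisation Nf) (k S : ℕ) (m : Fin Nf → ℝ) (M : ℝ) : ℝ :=
  (∫ U, (Multiset.countP (fun z : ℂ => z.im = 0 ∧ z.re < -(reg.mcrit k + reg.a k * M / reg.Zm k))
      (wilsonDirac (fundamentalRep (Fin 3)) U 0 1).charpoly.roots : ℝ) * ∏ f : Fin Nf, ‖fermionDet (wilsonDirac (fundamentalRep (Fin 3)) U (reg.mcrit k + reg.a k * m f / reg.Zm k) 1)‖ ∂(wilsonMeasure (d := 4) (L := 2 * S + 1) (fundamentalRep (Fin 3)) (reg.β k))) /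
    (∫ U, ∏ f : Fin Nf, ‖fermionDet (wilsonDirac (fundamentalRep (Fin 3)) U (reg.mcrit k + reg.a k * m f / reg.Zm k) 1)‖ ∂(wilsonMeasure (d := 4) (L := 2 * S + 1) (fundamentalRep (Fin 3)) (reg.β k)))

/-- The flavour-summed clause-(b) ratio at step `k`, torus half-side `S`, tuple `m`, window constant `c`:
phase-quenched expected number of eigenvalues of `Γ₅D_W(U, m_crit(k) + a_k m_f/Z_k, 1)` with
`|e| < c a_k m_f/Z_k`, summed over `f` (the quantity bounded in EXTB). -/
noncomputable def ratioB (reg : QCDRegularisation Nf) (c : ℝ) (k S : ℕ) (m : Fin Nf → ℝ) : ℝ :=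
  (∫ U, (∑ f : Fin Nf, (Multiset.countP (fun z : ℂ => |z.re| < c * (reg.a k * m f / reg.Zm k)) (spinorLift gammaFive * wilsonDirac (fundamentalRep (Fin 3)) U (reg.mcrit k + reg.a k * m f / reg.Zm k) 1).charpoly.roots : ℝ)) * ∏ f : Fin Nf, ‖fermionDet (wilsonDirac (fundamentalRep (Fin 3)) U (reg.mcrit k + reg.a k * m f / reg.Zm k) 1)‖ ∂(wilsonMeasure (d := 4) (L := 2 * S + 1) (fundamentalRep (Fin 3)) (reg.β k))) /
    (∫ U, ∏ f : Fin Nf, ‖fermionDet (wilsonDirac (fundamentalRep (Fin 3)) U (reg.mcrit k + reg.a k * m f / reg.Zm k) 1)‖ ∂(wilsonMeasure (d := 4) (L := 2 * S + 1) (fundamentalRep (Fin 3)) (reg.β k)))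

/-- **The EXTINCT ratio is the sum of the clause-(a) ratios at depths `m_f` and the clause-(b) ratio**
(every regularisation, window constant, step, torus and tuple; integrability of the bounded measurable
spectral counts against the phase-quenched weight, `Negative/ExtinctIntegrable.lean`). -/
theorem extinctRatio_eq_sum_ratioA_add_ratioB (reg : QCDRegularisation Nf) (c : ℝ) (k S : ℕ)
    (m : Fin Nf → ℝ) :
    extinctRatio reg c k S m = (∑ f : Fin Nf, ratioA reg k S m (m f)) + ratioB reg c k S m := by
  have hIA : ∀ f ∈ (Finset.univ : Finset (Fin Nf)), Integrable (fun U : GaugeConfig 4 (2 * S + 1) SU3 =>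
      (Multiset.countP (fun z : ℂ => z.im = 0 ∧ z.re < -(reg.mcrit k + reg.a k * m f / reg.Zm k))
          (wilsonDirac (fundamentalRep (Fin 3)) U 0 1).charpoly.roots : ℝ) *
        ∏ f : Fin Nf, ‖fermionDet (wilsonDirac (fundamentalRep (Fin 3)) U (reg.mcrit k + reg.a k * m f / reg.Zm k) 1)‖)
      (wilsonMeasure (d := 4) (L := 2 * S + 1) (fundamentalRep (Fin 3)) (reg.β k)) := fun f _ =>
    integrable_natCount_mul_weight (fun f => reg.mcrit k + reg.a k * m f / reg.Zm k) (reg.β k)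
      (measurable_signDefectCount _) (fun U => countP_roots_charpoly_le_card _ _)
  have hIB : ∀ f ∈ (Finset.univ : Finset (Fin Nf)), Integrable (fun U : GaugeConfig 4 (2 * S + 1) SU3 =>
      (Multiset.countP (fun z : ℂ => |z.re| < c * (reg.a k * m f / reg.Zm k)) (spinorLift gammaFive * wilsonDirac (fundamentalRep (Fin 3)) U (reg.mcrit k + reg.a k * m f / reg.Zm k) 1).charpoly.roots : ℝ) *
        ∏ f : Fin Nf, ‖fermionDet (wilsonDirac (fundamentalRep (Fin 3)) U (reg.mcrit k + reg.a k * m f / reg.Zm k) 1)‖)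
      (wilsonMeasure (d := 4) (L := 2 * S + 1) (fundamentalRep (Fin 3)) (reg.β k)) := fun f _ =>
    integrable_natCount_mul_weight (fun f => reg.mcrit k + reg.a k * m f / reg.Zm k) (reg.β k)
      (measurable_coercivityDefectCount _ _) (fun U => countP_roots_charpoly_le_card _ _)
  have hIBsum : Integrable (fun U : GaugeConfig 4 (2 * S + 1) SU3 =>
      (∑ f : Fin Nf, (Multiset.countP (fun z : ℂ => |z.re| < c * (reg.a k * m f / reg.Zm k)) (spinorLift gammaFive * wilsonDirac (fundamentalRep (Fin 3)) U (reg.mcrit k + reg.a k * m f / reg.Zm k) 1).charpoly.roots : ℝ)) *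
        ∏ f : Fin Nf, ‖fermionDet (wilsonDirac (fundamentalRep (Fin 3)) U (reg.mcrit k + reg.a k * m f / reg.Zm k) 1)‖)
      (wilsonMeasure (d := 4) (L := 2 * S + 1) (fundamentalRep (Fin 3)) (reg.β k)) := by
    simp_rw [Finset.sum_mul]
    exact integrable_finsetSum _ hIB
  unfold extinctRatio ratioA ratioB
  rw [← Finset.sum_div, ← add_div, ← integral_finsetSum _ hIA, ← integral_add (integrable_finsetSum _ hIA) hIBsum]
  congr 1
  refine integral_congr_ae (Eventually.of_forall fun U => ?_)
  simp only [Finset.sum_add_distrib, add_mul, Finset.sum_mul]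

/-- **S2b bookkeeping · `stub_windowCoercivity_bookkeeping` (fragment of `stub_windowCoercivity`).**
For every `N_f`, every regularisation `reg`, every threshold `M₀ ≥ 0` and every window constant `c`:
if the sub-level real modes are extinct in density form at every depth `M > M₀/2` (EXTA, the hypothesis of
S2b, verbatim) and the flavour-summed window count of the Hermitian Wilson–Dirac operators
`Γ₅D_W(U, m_f(k), 1)`, `m_f(k) = m_crit(k) + a_k m_f/Z_k`, in `|e| < c a_k m_f/Z_k` is extinct in density form
(EXTB(c)), then the crux's EXTINCT clause `Extinct N_f reg c m` holds at every tuple `m > M₀`.  The clause-(a)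
summand of flavour `f` is EXTA at depth `M := m_f` (`> M₀ ≥ M₀/2`); the EXTINCT ratio splits by
`extinctRatio_eq_sum_ratioA_add_ratioB`; the `N_f + 1` eventual sets at `ε/(N_f+1)` are intersected.  No
scaling hypothesis, no PINS and no (Hb) is used: given EXTA, S2b reduces to `∃ c > 0, EXTB(c)`. -/
theorem stub_windowCoercivity_bookkeeping :
    ∀ (Nf : ℕ) (reg : QCDRegularisation Nf) (M₀ c : ℝ), 0 ≤ M₀ →
      (∀ m : Fin Nf → ℝ, (∀ f, M₀ < m f) → ∀ M : ℝ, M₀ / 2 < M → ∀ ε : ℝ, 0 < ε →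
          ∀ᶠ k : ℕ in Filter.atTop, ∀ S : ℕ, reg.L k ≤ S →
          (∫ U, (Multiset.countP (fun z : ℂ => z.im = 0 ∧ z.re < -(reg.mcrit k + reg.a k * M / reg.Zm k))
              (wilsonDirac (fundamentalRep (Fin 3)) U 0 1).charpoly.roots : ℝ) * ∏ f : Fin Nf, ‖fermionDet (wilsonDirac (fundamentalRep (Fin 3)) U (reg.mcrit k + reg.a k * m f / reg.Zm k) 1)‖ ∂(wilsonMeasure (d := 4) (L := 2 * S + 1) (fundamentalRep (Fin 3)) (reg.β k))) /
            (∫ U, ∏ f : Fin Nf, ‖fermionDet (wilsonDirac (fundamentalRep (Fin 3)) U (reg.mcrit k + reg.a k * m f / reg.Zm k) 1)‖ ∂(wilsonMeasure (d := 4) (L := 2 * S + 1) (fundamentalRep (Fin 3)) (reg.β k))) ≤ ε * ((2 * S + 1 : ℝ) / (2 * reg.L k + 1)) ^ 4) →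
      (∀ m : Fin Nf → ℝ, (∀ f, M₀ < m f) → ∀ ε : ℝ, 0 < ε →
          ∀ᶠ k : ℕ in Filter.atTop, ∀ S : ℕ, reg.L k ≤ S →
          (∫ U, (∑ f : Fin Nf, (Multiset.countP (fun z : ℂ => |z.re| < c * (reg.a k * m f / reg.Zm k)) (spinorLift gammaFive * wilsonDirac (fundamentalRep (Fin 3)) U (reg.mcrit k + reg.a k * m f / reg.Zm k) 1).charpoly.roots : ℝ)) * ∏ f : Fin Nf, ‖fermionDet (wilsonDirac (fundamentalRep (Fin 3)) U (reg.mcrit k + reg.a k * m f / reg.Zm k) 1)‖ ∂(wilsonMeasure (d := 4) (L := 2 * S + 1) (fundamentalRep (Fin 3)) (reg.β k))) /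
            (∫ U, ∏ f : Fin Nf, ‖fermionDet (wilsonDirac (fundamentalRep (Fin 3)) U (reg.mcrit k + reg.a k * m f / reg.Zm k) 1)‖ ∂(wilsonMeasure (d := 4) (L := 2 * S + 1) (fundamentalRep (Fin 3)) (reg.β k))) ≤ ε * ((2 * S + 1 : ℝ) / (2 * reg.L k + 1)) ^ 4) →
      ∀ m : Fin Nf → ℝ, (∀ f, M₀ < m f) → Extinct Nf reg c m := by
  intro Nf reg M₀ c hM₀ hA hB m hm
  rw [extinct_iff_extinctRatio]
  intro ε hε
  -- the budget: `N_f + 1` pieces at `ε' = ε/(N_f+1)`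
  have hN : (0 : ℝ) < (Nf : ℝ) + 1 := by positivity
  obtain ⟨ε', hε'pos, hsumε⟩ : ∃ ε' : ℝ, 0 < ε' ∧ (∑ _f : Fin Nf, ε') + ε' = ε :=
    ⟨ε / ((Nf : ℝ) + 1), div_pos hε hN, by
      rw [Finset.sum_const, Finset.card_univ, Fintype.card_fin, nsmul_eq_mul]
      field_simp⟩
  -- clause (a), flavour by flavour, at depth `M := m f` (EXTA verbatim is a bound on `ratioA`)
  have hAf : ∀ f : Fin Nf, ∀ᶠ k : ℕ in Filter.atTop, ∀ S : ℕ, reg.L k ≤ S →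
      ratioA reg k S m (m f) ≤ ε' * ((2 * S + 1 : ℝ) / (2 * reg.L k + 1)) ^ 4 :=
    fun f => hA m hm (m f) (by linarith [hm f]) ε' hε'pos
  -- clause (b), all flavours at once (EXTB verbatim is a bound on `ratioB`)
  have hB' : ∀ᶠ k : ℕ in Filter.atTop, ∀ S : ℕ, reg.L k ≤ S →
      ratioB reg c k S m ≤ ε' * ((2 * S + 1 : ℝ) / (2 * reg.L k + 1)) ^ 4 := hB m hm ε' hε'pos
  filter_upwards [Filter.eventually_all.2 hAf, hB'] with k hkA hkB S hS
  rw [extinctRatio_eq_sum_ratioA_add_ratioB, ← hsumε, add_mul, Finset.sum_mul]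
  exact add_le_add (Finset.sum_le_sum fun f _ => hkA f S hS) (hkB S hS)


/-- The clause-(a) ratio is non-negative (non-negative integrand and weight). -/
theorem ratioA_nonneg (reg : QCDRegularisation Nf) (k S : ℕ) (m : Fin Nf → ℝ) (M : ℝ) :
    0 ≤ ratioA reg k S m M := by
  unfold ratioA
  exact div_nonneg (integral_nonneg fun U => mul_nonneg (Nat.cast_nonneg _)
    (Finset.prod_nonneg fun f _ => norm_nonneg _))
    (integral_nonneg fun U => Finset.prod_nonneg fun f _ => norm_nonneg _)

/-- The clause-(b) ratio is at most the EXTINCT ratio. -/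
theorem ratioB_le_extinctRatio (reg : QCDRegularisation Nf) (c : ℝ) (k S : ℕ) (m : Fin Nf → ℝ) :
    ratioB reg c k S m ≤ extinctRatio reg c k S m := by
  rw [extinctRatio_eq_sum_ratioA_add_ratioB]
  exact le_add_of_nonneg_left (Finset.sum_nonneg fun f _ => ratioA_nonneg reg k S m (m f))

/-- **Given EXTA, the conclusion of S2b at window constant `c` is EQUIVALENT to EXTB(c)** (every `N_f`, `reg`,
`M₀ ≥ 0`, `c`): the open content of `stub_windowCoercivity` is exactly a phase-quenched window-gap bound for the
Hermitian Wilson–Dirac operators at the bare masses `m_f(k)`, in density form on all tori `S ≥ L_k`. -/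
theorem extinct_iff_windowGap_of_extA (Nf : ℕ) (reg : QCDRegularisation Nf) (M₀ c : ℝ) (hM₀ : 0 ≤ M₀)
    (hA : ∀ m : Fin Nf → ℝ, (∀ f, M₀ < m f) → ∀ M : ℝ, M₀ / 2 < M → ∀ ε : ℝ, 0 < ε →
          ∀ᶠ k : ℕ in Filter.atTop, ∀ S : ℕ, reg.L k ≤ S →
          (∫ U, (Multiset.countP (fun z : ℂ => z.im = 0 ∧ z.re < -(reg.mcrit k + reg.a k * M / reg.Zm k))
              (wilsonDirac (fundamentalRep (Fin 3)) U 0 1).charpoly.roots : ℝ) * ∏ f : Fin Nf, ‖fermionDet (wilsonDirac (fundamentalRep (Fin 3)) U (reg.mcrit k + reg.a k * m f / reg.Zm k) 1)‖ ∂(wilsonMeasure (d := 4) (L := 2 * S + 1) (fundamentalRep (Fin 3)) (reg.β k))) /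
            (∫ U, ∏ f : Fin Nf, ‖fermionDet (wilsonDirac (fundamentalRep (Fin 3)) U (reg.mcrit k + reg.a k * m f / reg.Zm k) 1)‖ ∂(wilsonMeasure (d := 4) (L := 2 * S + 1) (fundamentalRep (Fin 3)) (reg.β k))) ≤ ε * ((2 * S + 1 : ℝ) / (2 * reg.L k + 1)) ^ 4) :
    (∀ m : Fin Nf → ℝ, (∀ f, M₀ < m f) → Extinct Nf reg c m) ↔
      (∀ m : Fin Nf → ℝ, (∀ f, M₀ < m f) → ∀ ε : ℝ, 0 < ε →
          ∀ᶠ k : ℕ in Filter.atTop, ∀ S : ℕ, reg.L k ≤ S →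
          (∫ U, (∑ f : Fin Nf, (Multiset.countP (fun z : ℂ => |z.re| < c * (reg.a k * m f / reg.Zm k)) (spinorLift gammaFive * wilsonDirac (fundamentalRep (Fin 3)) U (reg.mcrit k + reg.a k * m f / reg.Zm k) 1).charpoly.roots : ℝ)) * ∏ f : Fin Nf, ‖fermionDet (wilsonDirac (fundamentalRep (Fin 3)) U (reg.mcrit k + reg.a k * m f / reg.Zm k) 1)‖ ∂(wilsonMeasure (d := 4) (L := 2 * S + 1) (fundamentalRep (Fin 3)) (reg.β k))) /
            (∫ U, ∏ f : Fin Nf, ‖fermionDet (wilsonDirac (fundamentalRep (Fin 3)) U (reg.mcrit k + reg.a k * m f / reg.Zm k) 1)‖ ∂(wilsonMeasure (d := 4) (L := 2 * S + 1) (fundamentalRep (Fin 3)) (reg.β k))) ≤ ε * ((2 * S + 1 : ℝ) / (2 * reg.L k + 1)) ^ 4) := by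
  refine ⟨fun hE m hm ε hε => ?_, fun hB => stub_windowCoercivity_bookkeeping Nf reg M₀ c hM₀ hA hB⟩
  have h := (extinct_iff_extinctRatio reg c m).1 (hE m hm) ε hε
  filter_upwards [h] with k hk S hS
  exact (ratioB_le_extinctRatio reg c k S m).trans (hk S hS)

end Summit.QuantumFields.QCD.Cruxes.WindowExtinction.KatoRadiusCollectiveDefects

end
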